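import Summits.Ventures.PercRepro.Night2GoodTwoD2Shape

/-!
# night-2: the axes of a distance-2 target pass through one point

Let `T'` have the unique coloop `c`, `H = clF (T'.erase c)`, and let `W` be a set of points containing `c` (the points
of `G ∖ K` off `H`).  An AXIS of `T'` is a rank-`2` subset `R ⊆ T'.erase c` whose plane `clF (insert c R)` contains `W`
(the line of a covered lossy set loading `T'` at distance two is such an axis, by the covering).  Two axes spanning
different lines meet only in `clF W` (`axis_inter_subset_clF_W`), and `clF W ∩ H` carries at most one point when `W`
has rank `≤ 2` (`card_le_one_of_subset_clF_W`).  These are the geometric halves of the bound "at most three axes"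
(paper NIGHT-2-g30 §7.4); the counting half and the link to the loading pairs are the successor's.
-/

namespace PercRepro.Shadow

open PercRepro.ThmH PercRepro.PerFlat

variable {α : Type*} [DecidableEq α] {M : Matroid α} [M.Finite]

/-- `X ⊆ clF Y` with `rk Y ≤ rk X` gives `clF X = clF Y`. -/
theorem clF_eq_clF_of_subset_clF_of_rkN_le {X Y : Finset α} (hYg : Y ⊆ gr M) (hX : X ⊆ clF M Y)
    (hr : rkN M Y ≤ rkN M X) : clF M X = clF M Y := by
  have hXg : X ⊆ gr M := fun a ha => mem_gr_of_mem_clF (hX ha)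
  have hsub : clF M X ⊆ clF M Y := clF_subset_clF_of_subset_clF hX
  refine le_antisymm hsub ?_
  -- `Y ⊆ clF X`: the ranks of `X` and `Y ∪ X` agree
  have hYX : rkN M (Y ∪ X) ≤ rkN M Y := by
    have h1 : Y ∪ X ⊆ clF M Y := Finset.union_subset (fun a ha => subset_clF_of_subset_gr hYg ha) hX
    have := rkN_mono (M := M) h1
    rw [rkN_clF] at this
    exact this
  have hXYX : rkN M X ≤ rkN M (Y ∪ X) := rkN_mono (M := M) Finset.subset_union_right
  have hY : Y ⊆ clF M X := fun a ha =>
    mem_clF_of_rkN_eq (X := X) (Y := Y ∪ X) Finset.subset_union_right (Finset.union_subset hYg hXg)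
      (by omega) (Finset.mem_union_left _ ha)
  exact clF_subset_clF_of_subset_clF hY

/-- A rank-`2` set `R` inside a flat `H` missing the point `c`: every point of `H` in the plane `clF (insert c R)`
lies on the line `clF R`. -/
theorem mem_clF_of_mem_plane_of_mem_H {H R : Finset α} (hHg : H ⊆ gr M) (hRH : R ⊆ H) (hR2 : rkN M R = 2) {c : α} (hcg : c ∈ gr M)
    (hcH : c ∉ clF M H) {y : α} (hyH : y ∈ H) (hyP : y ∈ clF M (insert c R)) : y ∈ clF M R := by
  by_contra hy
  have hRg : R ⊆ gr M := hRH.trans hHg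
  have hcR : c ∉ clF M R := fun h => hcH (clF_mono hRH h)
  have h1 := rkN_insert_of_notMem_clF (hHg hyH) hy
  have h2 := rkN_insert_of_notMem_clF hcg hcR
  -- `clF (insert y R) = clF (insert c R)` by ranks, so `c ∈ clF (insert y R) ⊆ clF H`
  have hsub : insert y R ⊆ clF M (insert c R) := by
    intro a ha
    rw [Finset.mem_insert] at ha
    rcases ha with rfl | ha
    · exact hyP
    · exact subset_clF_of_subset_gr (Finset.insert_subset hcg hRg) (Finset.mem_insert_of_mem ha)
  have heq := clF_eq_clF_of_subset_clF_of_rkN_le (Finset.insert_subset hcg hRg) hsub (by omega)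
  have hc : c ∈ clF M (insert y R) := by
    rw [heq]
    exact subset_clF_of_subset_gr (Finset.insert_subset hcg hRg) (Finset.mem_insert_self _ _)
  exact hcH (clF_mono (Finset.insert_subset hyH hRH) hc)

/-- **Two axes spanning different lines meet only in `clF W`.** -/
theorem axis_inter_subset_clF_W (hs : ∀ e ∈ gr M, ∀ f ∈ gr M, e ≠ f → rkN M {e, f} = 2)
    {H : Finset α} (hHg : H ⊆ gr M) {c : α} (hcg : c ∈ gr M) (hcH : c ∉ clF M H)
    {W : Finset α} (hWg : W ⊆ gr M) (hcW : c ∈ W) {c' : α} (hc'W : c' ∈ W) (hcc' : c ≠ c')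
    {R R' : Finset α} (hRH : R ⊆ H) (hR'H : R' ⊆ H) (hR2 : rkN M R = 2) (hR'2 : rkN M R' = 2)
    (hWR : W ⊆ clF M (insert c R)) (hWR' : W ⊆ clF M (insert c R')) (hne : clF M R ≠ clF M R')
    {p : α} (hpR : p ∈ R) (hpR' : p ∈ R') : p ∈ clF M W := by
  by_contra hpW
  have hRg : R ⊆ gr M := hRH.trans hHg
  have hR'g : R' ⊆ gr M := hR'H.trans hHg
  have hcR : c ∉ clF M R := fun h => hcH (clF_mono hRH h)
  have hcR' : c ∉ clF M R' := fun h => hcH (clF_mono hR'H h)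
  have hrP : rkN M (insert c R) = 3 := by rw [rkN_insert_of_notMem_clF hcg hcR, hR2]
  have hrP' : rkN M (insert c R') = 3 := by rw [rkN_insert_of_notMem_clF hcg hcR', hR'2]
  -- `rk (insert p W) ≥ 3`
  have hW2 : 2 ≤ rkN M W := by
    have := rkN_mono (M := M) (show ({c, c'} : Finset α) ⊆ W by
      intro a ha; rw [Finset.mem_insert, Finset.mem_singleton] at ha
      rcases ha with rfl | rfl; exacts [hcW, hc'W])
    rw [hs c hcg c' (hWg hc'W) hcc'] at this
    exact this
  have hpW3 : 3 ≤ rkN M (insert p W) := by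
    rw [rkN_insert_of_notMem_clF (hRg hpR) hpW]
    omega
  -- the plane of each axis is `clF (insert p W)`
  have hsubP : insert p W ⊆ clF M (insert c R) := by
    intro a ha
    rw [Finset.mem_insert] at ha
    rcases ha with rfl | ha
    · exact subset_clF_of_subset_gr (Finset.insert_subset hcg hRg) (Finset.mem_insert_of_mem hpR)
    · exact hWR ha
  have hsubP' : insert p W ⊆ clF M (insert c R') := by
    intro a ha
    rw [Finset.mem_insert] at ha
    rcases ha with rfl | ha
    · exact subset_clF_of_subset_gr (Finset.insert_subset hcg hR'g) (Finset.mem_insert_of_mem hpR')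
    · exact hWR' ha
  have heq := clF_eq_clF_of_subset_clF_of_rkN_le (Finset.insert_subset hcg hRg) hsubP (by omega)
  have heq' := clF_eq_clF_of_subset_clF_of_rkN_le (Finset.insert_subset hcg hR'g) hsubP' (by omega)
  have hPP : clF M (insert c R) = clF M (insert c R') := heq.symm.trans heq'
  -- hence each axis lies on the other's line
  apply hne
  apply le_antisymm
  · apply clF_subset_clF_of_subset_clF
    intro y hy
    apply mem_clF_of_mem_plane_of_mem_H hHg hR'H hR'2 hcg hcH (hRH hy)
    rw [← hPP]
    exact subset_clF_of_subset_gr (Finset.insert_subset hcg hRg) (Finset.mem_insert_of_mem hy)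
  · apply clF_subset_clF_of_subset_clF
    intro y hy
    apply mem_clF_of_mem_plane_of_mem_H hHg hRH hR2 hcg hcH (hR'H hy)
    rw [hPP]
    exact subset_clF_of_subset_gr (Finset.insert_subset hcg hR'g) (Finset.mem_insert_of_mem hy)

/-- **`clF W ∩ H` has at most one point** when `W ∋ c` has rank `≤ 2` and `c ∉ clF H`. -/
theorem card_le_one_of_subset_clF_W (hs : ∀ e ∈ gr M, ∀ f ∈ gr M, e ≠ f → rkN M {e, f} = 2)
    {H : Finset α} (hHg : H ⊆ gr M) {c : α} (hcH : c ∉ clF M H) {W : Finset α} (hWg : W ⊆ gr M)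
    (hcW : c ∈ W) (hW2 : rkN M W ≤ 2) {X : Finset α} (hXW : X ⊆ clF M W) (hXH : X ⊆ H) : X.card ≤ 1 := by
  rw [Finset.card_le_one]
  intro p hp q hq
  by_contra hne
  have hXg : X ⊆ gr M := hXH.trans hHg
  have hpair : ({p, q} : Finset α) ⊆ clF M W := by
    intro a ha
    rw [Finset.mem_insert, Finset.mem_singleton] at ha
    rcases ha with rfl | rfl
    · exact hXW hp
    · exact hXW hq
  have h2 := hs p (hXg hp) q (hXg hq) hne
  have heq := clF_eq_clF_of_subset_clF_of_rkN_le hWg hpair (by omega)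
  have hc : c ∈ clF M ({p, q} : Finset α) := by
    rw [heq]
    exact subset_clF_of_subset_gr hWg hcW
  apply hcH
  apply clF_mono _ hc
  intro a ha
  rw [Finset.mem_insert, Finset.mem_singleton] at ha
  rcases ha with rfl | rfl
  · exact hXH hp
  · exact hXH hq

omit [M.Finite] in
/-- **The counting half**: a family `Ax` of subsets of a set `U` of at most `r + 4` points, each of `r ≥ 3` points,
any two distinct members meeting only in the fixed point `p₀`, has at most three members. -/
theorem card_le_three_of_pairwise_inter_subset {U : Finset α} {Ax : Finset (Finset α)} {r : ℕ} (hr : 3 ≤ r)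
    (hU : U.card ≤ r + 4) (hsub : ∀ R ∈ Ax, R ⊆ U) (hcard : ∀ R ∈ Ax, R.card = r) {p₀ : α}
    (hinter : ∀ R ∈ Ax, ∀ R' ∈ Ax, R ≠ R' → ∀ p ∈ R, p ∈ R' → p = p₀) : Ax.card ≤ 3 := by
  -- the sets `R.erase p₀` are pairwise disjoint inside `U`
  have hdisj : (Ax : Set (Finset α)).PairwiseDisjoint (fun R => R.erase p₀) := by
    intro R hR R' hR' hne
    rw [Function.onFun, Finset.disjoint_left]
    intro p hp hp'
    rw [Finset.mem_erase] at hp hp'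
    exact hp.1 (hinter R hR R' hR' hne p hp.2 hp'.2)
  have hunion : Ax.biUnion (fun R => R.erase p₀) ⊆ U := by
    intro p hp
    rw [Finset.mem_biUnion] at hp
    obtain ⟨R, hR, hpR⟩ := hp
    exact hsub R hR (Finset.mem_erase.1 hpR).2
  have h1 := Finset.card_le_card hunion
  rw [Finset.card_biUnion hdisj] at h1
  have h2 : Ax.card • (r - 1) ≤ ∑ R ∈ Ax, (R.erase p₀).card := by
    apply Finset.card_nsmul_le_sum
    intro R hR
    have := Finset.pred_card_le_card_erase (s := R) (a := p₀)
    rw [hcard R hR] at this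
    exact this
  rw [smul_eq_mul] at h2
  by_contra h4
  push Not at h4
  have h5 : 4 * (r - 1) ≤ Ax.card * (r - 1) := Nat.mul_le_mul_right _ h4
  omega

end PercRepro.Shadow
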